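import Summits.QuantumAdvantage.QuantumAdvantage.Theorems.RankDialL8
import Summits.QuantumAdvantage.QuantumAdvantage.Theorems.RankDialL2
import HarnessLib

/-!
# RankDial (L9) — §42 THE PERTURB LAW OF THE BLOCK DIAL IS A THEOREM: `BlockJSpan p η` for every `η ≥ 1`, `p ≠ 3`; the residual of the dial

TARGET BY NAME (cell decomp-qadv, RESIDUAL MODE): item stmt-QuantumAdvantage-23109
`Summit.QuantumAdvantage.QuantumAdvantage.Theses.OddPrimeWalk.ManyReadersSqrtOdd`, through rung R5 = `AdviceFreeQNC0.WalkHardFLinSel p`.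
This file SUPPORTS the item (`--supports`); it does not close it.  Declaration bodies are byte-identical to §42 of the cell node
«BlockDial» (decomp-qadv lens-1, generation 27, part L; node file RankDialL.lean, rev 6).  PROVED: `norm_labelParSum_le_jrank` — under
the junta-rank grade `JRankLE p y lam s D` (part K1) the `labelPar`-twisted sums against ANY weight `E` whose degree-`≤ s` twisted character
sums are `≤ B` are `≤ p^D·B` (K1's level-set expansion, verbatim, for label parities); `win_fibre_le_block_jrank` — the block fibre theorem
`#WIN_fibre ≤ (2/3)·2^ℓ + 3^{J+1}·p^D·2^ℓ·exp(−η_p·⌊ℓ/η⌋/4^{s+1})` (canonical skeleton of part L8 + engine of part L6); `block_err_absorb`,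
`succ_lt_two_mul_of_mul_div_le` (`J + 1 < 2η`), `win_fibre_le_block_jrank_absorbed` (`≤ (11/12)·2^ℓ`); ★★ `blockJSpan_holds : p ≠ 3 → 1 ≤ η →
BlockJSpan p η` (Fubini; `θ = 11/12`, budget unit `η·(2η+1)·M`, `2·4^{s+1} ≤ M·η_p`) — the perturb law of part L2 at EVERY notch of the
block dial; hence `blockPiece_iff_blockJSpread : BlockPiece p η ↔ BlockJSpread p η s`, `r5_iff_block_residual : 5 ≤ p → 1 ≤ η →
(WalkHardFLinSel p ↔ BlockJSpread p η s ∧ ClusteredPiece p η)`, `r5_of_block_residual`, and the assembly to the target by name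
`closes_block_residual` / `target_iff_block_residual` (residual + core at every `p ≥ 5` + the lift `R5LiftOdd`).  Imports parts L8 and L2.
-/

set_option linter.dupNamespace false
set_option autoImplicit false

noncomputable section
open Classical

namespace Summit.QuantumAdvantage.QuantumAdvantage.Theorems.RankDial

open Finset
open Summit.QuantumAdvantage.AdviceFreeQNC0
open Literature.Computability.MetaComplexity Literature.Computability.MetaComplexity.Smolensky

/-! ### §42 (part L «BlockDial») THE PERTURB LAW OF THE BLOCK DIAL IS A THEOREM: `BlockJSpan p η` for every `η ≥ 1`, `p ≠ 3` (`θ = 11/12`) -/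

section BlockSpanLaw
variable {p : ℕ} [Fact p.Prime] {L ℓ R : ℕ} (c : ℕ) (y : Fin (L + ℓ + R + 1) → (Fin (L + ℓ + R) → Bool) → Bool)
  (lam : Fin (L + ℓ + R + 1) → Fin (L + ℓ + R) → ZMod p) (rr : Fin (L + ℓ + R + 1) → ZMod p)

/-- **THE TWISTED LABEL-PARITY SUMS UNDER THE JUNTA-RANK GRADE** (the `J`-label twin of part K1 `norm_classSum_le_jrank`, for an
ARBITRARY weight `E`): if the wide cuts answer on the fibre through `≤ D` linear forms `Φ` and `≤ s` own bits (`JRankLE p y lam s D`),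
and every degree-`≤ s` sign twisted by `E` and by any window character `e_p(μ·v)` has sum `≤ B`, then for every classification
`kind` and label `z`: `‖Σ_v (−1)^{labelPar kind z v}·E v‖ ≤ p^D·B`.  Proof = K1's: split the alive cuts into narrow (an `s`-junta sum
`Qn`) and wide; expand the wide product over the `p^d` level sets of `Φ` (`comp_eq_sum_prod_indC`); on each level set the wide signs
are an `𝔽₂`-polynomial of degree `≤ s`; the level-set indicator is free (`norm_sum_mul_prod_indC_le`). -/
theorem norm_labelParSum_le_jrank
    (hyl : ∀ g u, y g u = decide ((∑ i, if u i then lam g i else 0) = rr g))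
    (a : Fin L → Bool) (b : Fin R → Bool) {s D : ℕ} (hJR : JRankLE p y lam s D)
    {J : ℕ} (kind : Fin (L + ℓ + R + 1) → Option (Fin J)) (z : ZMod 3 × (Fin J → ZMod 3))
    (E : (Fin ℓ → Bool) → ℂ) {B : ℝ}
    (hE : ∀ Q ∈ lowDeg (ZMod 2) ℓ s, ∀ μ : Fin ℓ → ZMod p,
      ‖∑ v : Fin ℓ → Bool, GowersCube.signChar (Q v) * (E v * ZMod.stdAddChar (linPart μ v))‖ ≤ B) :
    ‖∑ v : Fin ℓ → Bool, GowersCube.signChar (labelPar c y a b kind z v) * E v‖ ≤ (p : ℝ) ^ D * B := by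
  classical
  obtain ⟨d, hd, Φ, hΦ⟩ := hJR
  set Gr := univ.filter (fun g : Fin (L + ℓ + R + 1) => z.1 + coordOf z (kind g) ≠ deadVal ℓ c a b g.val) with hGr
  set Wr := Gr.filter (fun g => s < (wsupp lam g).card) with hWr
  set Nr := Gr.filter (fun g => ¬ s < (wsupp lam g).card) with hNr
  set Qn : CubeFn (ZMod 2) ℓ := ∑ g ∈ Nr, fireFn y a b g with hQn_def
  have hQn : Qn ∈ lowDeg (ZMod 2) ℓ s := Submodule.sum_mem _ fun g hg =>
    lowDeg_mono (not_lt.1 (Finset.mem_filter.1 hg).2) (fireFn_mem_lowDeg_wsupp y lam rr hyl g a b)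
  have hsplit : labelPar c y a b kind z = (∑ g ∈ Wr, fireFn y a b g) + Qn := by
    rw [hQn_def, hWr, hNr, Finset.sum_filter_add_sum_filter_not, hGr]
    rfl
  -- the wide cuts answer through Φ and ≤ s own bits on this fibre
  have key : ∀ g : Fin (L + ℓ + R + 1), ∃ S : Finset (Fin ℓ), ∃ T : (Fin d → ZMod p) → (Fin ℓ → Bool) → Bool,
      g ∈ Wr → (S.card ≤ s ∧ (∀ x, ∀ v w : Fin ℓ → Bool, (∀ i ∈ S, v i = w i) → T x v = T x w) ∧
        ∀ v, y g (glue3 a v b) = T (fun k => linPart (Φ k) v) v) := by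
    intro g
    by_cases hg : g ∈ Wr
    · obtain ⟨S, hS, T, hT, hfire⟩ := hΦ g (Finset.mem_filter.1 hg).2 a b
      exact ⟨S, T, fun _ => ⟨hS, hT, hfire⟩⟩
    · exact ⟨∅, fun _ _ => false, fun h => absurd h hg⟩
  choose Sg Tg hkey using key
  -- level-set polynomials of the wide cuts
  let P : (Fin d → ZMod p) → CubeFn (ZMod 2) ℓ := fun x =>
    ∑ g ∈ Wr, fun v => if Tg g x v = true then (1 : ZMod 2) else 0
  have hP : ∀ x, P x ∈ lowDeg (ZMod 2) ℓ s := fun x =>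
    Submodule.sum_mem _ fun g hg => lowDeg_mono (hkey g hg).1
      (junta_mem_lowDeg (Sg g) _ fun v w hvw => by
        show (if Tg g x v = true then (1 : ZMod 2) else 0) = if Tg g x w = true then 1 else 0
        rw [(hkey g hg).2.1 x v w hvw])
  have hFP : ∀ x v, (∏ g ∈ Wr, if Tg g x v = true then (-1 : ℂ) else 1) = GowersCube.signChar (P x v) := by
    intro x v
    show _ = GowersCube.signChar ((∑ g ∈ Wr, fun v => if Tg g x v = true then (1 : ZMod 2) else 0) v)
    rw [Finset.sum_apply, signChar_finset_sum]
    refine Finset.prod_congr rfl fun g _ => ?_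
    by_cases h : Tg g x v = true <;> simp [h]
  have hsgn : ∀ v, GowersCube.signChar (labelPar c y a b kind z v) =
      GowersCube.signChar (Qn v) * ∏ g ∈ Wr, (if Tg g (fun k => linPart (Φ k) v) v = true then (-1 : ℂ) else 1) := by
    intro v
    rw [hsplit, Pi.add_apply, GowersCube.signChar_add, Finset.sum_apply, signChar_finset_sum, mul_comm]
    congr 1
    refine Finset.prod_congr rfl fun g hg => ?_
    rw [signChar_fireFn_eq_ite, (hkey g hg).2.2 v]
  have hcomp : ∀ v, (∏ g ∈ Wr, if Tg g (fun k => linPart (Φ k) v) v = true then (-1 : ℂ) else 1) =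
      ∑ x : Fin d → ZMod p, (∏ g ∈ Wr, if Tg g x v = true then (-1 : ℂ) else 1) * ∏ k, indC (Φ k) (x k) v := by
    intro v
    have h := comp_eq_sum_prod_indC Φ (fun x => ∏ g ∈ Wr, (if Tg g x v = true then (-1 : ℂ) else 1)) v
    simpa only using h
  have hpt : ∀ v, GowersCube.signChar (labelPar c y a b kind z v) * E v =
      ∑ x : Fin d → ZMod p, (GowersCube.signChar ((Qn + P x) v) * E v) * ∏ k, indC (Φ k) (x k) v := by
    intro v
    rw [hsgn v, hcomp v, Finset.mul_sum, Finset.sum_mul]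
    refine Finset.sum_congr rfl fun x _ => ?_
    rw [hFP x v, Pi.add_apply, GowersCube.signChar_add]
    ring
  have hA : ∀ (x : Fin d → ZMod p) (μ : Fin ℓ → ZMod p),
      ‖∑ v, (GowersCube.signChar ((Qn + P x) v) * E v) * ZMod.stdAddChar (linPart μ v)‖ ≤ B := by
    intro x μ
    have h := hE (Qn + P x) (Submodule.add_mem _ hQn (hP x)) μ
    simpa only [mul_assoc] using h
  have h0 : ∀ v : Fin ℓ → Bool, (ZMod.stdAddChar (linPart (0 : Fin ℓ → ZMod p) v) : ℂ) = 1 := by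
    intro v
    rw [show linPart (0 : Fin ℓ → ZMod p) v = 0 by simp [linPart], AddChar.map_zero_eq_one]
  have hx : ∀ x : Fin d → ZMod p,
      ‖∑ v, (GowersCube.signChar ((Qn + P x) v) * E v) * ∏ k, indC (Φ k) (x k) v‖ ≤ B := by
    intro x
    have h := norm_sum_mul_prod_indC_le _ (hA x) univ Φ x 0
    simp_rw [h0, mul_one] at h
    exact h
  have hB : 0 ≤ B := le_trans (norm_nonneg _) (hx fun _ => 0)
  have hp1 : (1 : ℝ) ≤ p := by exact_mod_cast (Fact.out : p.Prime).one_lt.le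
  calc ‖∑ v, GowersCube.signChar (labelPar c y a b kind z v) * E v‖
      = ‖∑ v : Fin ℓ → Bool, ∑ x : Fin d → ZMod p, (GowersCube.signChar ((Qn + P x) v) * E v) *
          ∏ k, indC (Φ k) (x k) v‖ := by
        congr 1
        exact Finset.sum_congr rfl fun v _ => hpt v
    _ = ‖∑ x : Fin d → ZMod p, ∑ v : Fin ℓ → Bool, (GowersCube.signChar ((Qn + P x) v) * E v) *
          ∏ k, indC (Φ k) (x k) v‖ := by rw [Finset.sum_comm]
    _ ≤ ∑ x : Fin d → ZMod p, ‖∑ v : Fin ℓ → Bool, (GowersCube.signChar ((Qn + P x) v) * E v) *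
          ∏ k, indC (Φ k) (x k) v‖ := norm_sum_le _ _
    _ ≤ ∑ _x : Fin d → ZMod p, B := Finset.sum_le_sum fun x _ => hx x
    _ = (p : ℝ) ^ d * B := by
        rw [Finset.sum_const, Finset.card_univ, Fintype.card_fun, ZMod.card, Fintype.card_fin, nsmul_eq_mul]
        push_cast
        ring
    _ ≤ (p : ℝ) ^ D * B := mul_le_mul_of_nonneg_right (pow_le_pow_right₀ hp1 hd) hB

/-- **THE BLOCK FIBRE THEOREM** (`p ≠ 3`, linear tests, `η`-separated block, junta rank `≤ D` at width `s`): on every outside fibre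
`#{v : WIN(a ++ v ++ b)} ≤ (2/3)·2^ℓ + 3^{J+1}·p^D·2^ℓ·exp(−η_p·⌊ℓ/η⌋/4^{s+1})`, `J` = the number of inside fibre-live cuts — the canonical
skeleton (§41) fed with `norm_labelParSum_le_jrank` and the engine `norm_twisted_blockLabel_fibreLive_le` (§38/§41). -/
theorem win_fibre_le_block_jrank (hp3 : p ≠ 3)
    (hyl : ∀ g u, y g u = decide ((∑ i, if u i then lam g i else 0) = rr g)) {η : ℕ} (hsep : SepBlock y L ℓ η)
    {s D : ℕ} (hJR : JRankLE p y lam s D) (a : Fin L → Bool) (b : Fin R → Bool) :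
    ((univ.filter fun v : Fin ℓ → Bool => ringWinU c y (glue3 a v b) = true).card : ℝ) ≤
      2 / 3 * 2 ^ ℓ + 3 ^ ((insideCuts L ℓ (fibreLive y a b)).card + 1) *
        ((p : ℝ) ^ D * (2 ^ ℓ * Real.exp (-(etaP p * (ℓ / η : ℕ) / 4 ^ (s + 1))))) := by
  have hp1 : (1 : ℝ) ≤ (p : ℝ) ^ D := one_le_pow₀ (by exact_mod_cast (Fact.out : p.Prime).one_lt.le)
  refine win_fibre_le_of_labelSums_canonical c y a b (fun t ht => ?_) (fun z t ht => ?_)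
  · have hQ0 : (0 : CubeFn (ZMod 2) ℓ) ∈ lowDeg (ZMod 2) ℓ s := Submodule.zero_mem _
    have h := norm_twisted_blockLabel_fibreLive_le y a b hp3 hsep hQ0 (0 : Fin ℓ → ZMod p) t ht
    have h0 : ∀ v : Fin ℓ → Bool, (ZMod.stdAddChar (linPart (0 : Fin ℓ → ZMod p) v) : ℂ) = 1 := by
      intro v
      rw [show linPart (0 : Fin ℓ → ZMod p) v = 0 by simp [linPart], AddChar.map_zero_eq_one]
    have h1 : ∀ v : Fin ℓ → Bool, GowersCube.signChar ((0 : CubeFn (ZMod 2) ℓ) v) = 1 := fun v => by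
      simp [GowersCube.signChar]
    simp_rw [h0, h1, mul_one, one_mul] at h
    exact h.trans (le_mul_of_one_le_left (by positivity) hp1)
  · exact norm_labelParSum_le_jrank c y lam rr hyl a b hJR _ z _ fun Q hQ μ =>
      norm_twisted_blockLabel_fibreLive_le y a b hp3 hsep hQ μ t ht

omit [Fact p.Prime] in
/-- Error absorption for the block law (from part H2 `mixed_err_absorb`): `2·4^{s+1} ≤ M·η'`, `(k + 2)·M ≤ q ≤ ℓ`
⟹ `4·3^k·2^ℓ·exp(−η' q/4^{s+1}) ≤ 2^ℓ`. -/
theorem block_err_absorb {η' : ℝ} (hη0 : 0 < η') (hη2 : η' ≤ 2) {s M k q ℓ' : ℕ}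
    (hM : 2 * 4 ^ (s + 1) ≤ (M : ℝ) * η') (hq : (k + 2) * M ≤ q) (hqℓ : q ≤ ℓ') :
    4 * (3 : ℝ) ^ k * (2 ^ ℓ' * Real.exp (-(η' * q / 4 ^ (s + 1)))) ≤ (2 : ℝ) ^ ℓ' := by
  have h := mixed_err_absorb hη0 hη2 hM hq
  have hsplit : (2 : ℝ) ^ ℓ' = 2 ^ (ℓ' - q) * 2 ^ q := by rw [← pow_add, Nat.sub_add_cancel hqℓ]
  have hpos : (0 : ℝ) ≤ 2 ^ (ℓ' - q) := by positivity
  have h2 : 4 * (3 : ℝ) ^ k * (2 ^ q * Real.exp (-(η' * q / 4 ^ (s + 1)))) ≤ 2 ^ q := by linarith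
  calc 4 * (3 : ℝ) ^ k * (2 ^ ℓ' * Real.exp (-(η' * q / 4 ^ (s + 1))))
      = 2 ^ (ℓ' - q) * (4 * 3 ^ k * (2 ^ q * Real.exp (-(η' * q / 4 ^ (s + 1))))) := by rw [hsplit]; ring
    _ ≤ 2 ^ (ℓ' - q) * 2 ^ q := mul_le_mul_of_nonneg_left h2 hpos
    _ = 2 ^ ℓ' := by rw [hsplit]

omit [Fact p.Prime] in
/-- Counting: `(J + 1)·q ≤ ℓ`, `q = ⌊ℓ/η⌋ ≥ 1` ⟹ `J + 1 < 2η`. -/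
theorem succ_lt_two_mul_of_mul_div_le {J q ℓ' η : ℕ} (hη : 0 < η) (hq : q = ℓ' / η) (hq1 : 1 ≤ q)
    (hJ : (J + 1) * q ≤ ℓ') : J + 1 < 2 * η := by
  have hlt : ℓ' < q * η + η := by rw [hq]; exact Nat.lt_div_mul_add hη
  have hηq : η ≤ q * η := Nat.le_mul_of_pos_left η hq1
  have h1 : (J + 1) * q < (2 * η) * q := by
    have e : (2 * η) * q = q * η + q * η := by ring
    rw [e]
    omega
  exact Nat.lt_of_mul_lt_mul_right h1

/-- **THE BLOCK FIBRE THEOREM, absorbed**: `2·4^{s+1} ≤ M·η_p`, `(p·D + 2η + 2)·M ≤ ⌊ℓ/η⌋`, `1 ≤ η` ⟹ `#WIN_fibre ≤ (11/12)·2^ℓ`. -/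
theorem win_fibre_le_block_jrank_absorbed (hp3 : p ≠ 3)
    (hyl : ∀ g u, y g u = decide ((∑ i, if u i then lam g i else 0) = rr g)) {η : ℕ} (hη : 1 ≤ η)
    (hsep : SepBlock y L ℓ η) {s D M : ℕ} (hM : 2 * 4 ^ (s + 1) ≤ (M : ℝ) * etaP p) (hJR : JRankLE p y lam s D)
    (hq : (p * D + 2 * η + 2) * M ≤ ℓ / η) (hq1 : 1 ≤ ℓ / η) (a : Fin L → Bool) (b : Fin R → Bool) :
    ((univ.filter fun v : Fin ℓ → Bool => ringWinU c y (glue3 a v b) = true).card : ℝ) ≤ 11 / 12 * 2 ^ ℓ := by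
  have h1 := win_fibre_le_block_jrank c y lam rr hp3 hyl hsep hJR a b
  have hJq := succ_card_insideCuts_fibreLive_mul_le y a b hsep
  have hJ : (insideCuts L ℓ (fibreLive y a b)).card + 1 < 2 * η :=
    succ_lt_two_mul_of_mul_div_le hη rfl hq1 hJq
  have h3J : (3 : ℝ) ^ ((insideCuts L ℓ (fibreLive y a b)).card + 1) ≤ 3 ^ (2 * η) :=
    pow_le_pow_right₀ (by norm_num) hJ.le
  have hpD : (p : ℝ) ^ D ≤ 3 ^ (p * D) := pow_le_three_pow_mul (p := p) D
  have hqℓ : ℓ / η ≤ ℓ := Nat.div_le_self ℓ η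
  have herr := block_err_absorb (etaP_pos (p := p)) (etaP_le_two p) hM hq hqℓ
  have hW : (0 : ℝ) ≤ 2 ^ ℓ * Real.exp (-(etaP p * (ℓ / η : ℕ) / 4 ^ (s + 1))) := by positivity
  have step : (3 : ℝ) ^ ((insideCuts L ℓ (fibreLive y a b)).card + 1) *
      ((p : ℝ) ^ D * (2 ^ ℓ * Real.exp (-(etaP p * (ℓ / η : ℕ) / 4 ^ (s + 1))))) ≤
      3 ^ (p * D + 2 * η) * (2 ^ ℓ * Real.exp (-(etaP p * (ℓ / η : ℕ) / 4 ^ (s + 1)))) := by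
    have e1 : (3 : ℝ) ^ ((insideCuts L ℓ (fibreLive y a b)).card + 1) *
        ((p : ℝ) ^ D * (2 ^ ℓ * Real.exp (-(etaP p * (ℓ / η : ℕ) / 4 ^ (s + 1))))) =
        (3 ^ ((insideCuts L ℓ (fibreLive y a b)).card + 1) * (p : ℝ) ^ D) *
          (2 ^ ℓ * Real.exp (-(etaP p * (ℓ / η : ℕ) / 4 ^ (s + 1)))) := by ring
    have e2 : (3 : ℝ) ^ (p * D + 2 * η) * (2 ^ ℓ * Real.exp (-(etaP p * (ℓ / η : ℕ) / 4 ^ (s + 1)))) =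
        (3 ^ (2 * η) * 3 ^ (p * D)) * (2 ^ ℓ * Real.exp (-(etaP p * (ℓ / η : ℕ) / 4 ^ (s + 1)))) := by
      rw [pow_add (3 : ℝ) (p * D) (2 * η)]
      ring
    rw [e1, e2]
    exact mul_le_mul_of_nonneg_right (mul_le_mul h3J hpD (by positivity) (by positivity)) hW
  linarith

end BlockSpanLaw

section BlockSpanPiece
variable (p : ℕ) [Fact p.Prime]

/-- **THE PERTURB LAW OF THE BLOCK DIAL IS A THEOREM** for every prime `p ≠ 3` and every `η ≥ 1` (`θ = 11/12`; budget unit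
`M_η = η·(2η + 1)·M` with `2·4^{s+1} ≤ M·η_p`): `BlockJSpan p η`.  Fubini over the outside fibres of `win_fibre_le_block_jrank_absorbed`. -/
theorem blockJSpan_holds (hp3 : p ≠ 3) {η : ℕ} (hη : 1 ≤ η) : BlockJSpan p η := by
  intro s
  obtain ⟨M, hM⟩ : ∃ M : ℕ, 2 * 4 ^ (s + 1) ≤ (M : ℝ) * etaP p := by
    obtain ⟨M, hM⟩ := exists_nat_ge (2 * 4 ^ (s + 1) / etaP p)
    exact ⟨M, by rwa [div_le_iff₀ (etaP_pos (p := p))] at hM⟩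
  have hM1 : 1 ≤ M := by
    rcases Nat.eq_zero_or_pos M with h0 | h0
    · exfalso
      rw [h0] at hM
      have h4 : (0 : ℝ) < 2 * 4 ^ (s + 1) := by positivity
      have h' : (2 : ℝ) * 4 ^ (s + 1) ≤ 0 := by simpa using hM
      linarith
    · exact h0
  refine ⟨11 / 12, by norm_num, η * (2 * η + 1) * M, fun L ℓ R c y lam rr hyl hsep D hJR hℓ => ?_⟩
  have hη0 : 0 < η := hη
  have hq : (p * D + 2 * η + 2) * M ≤ ℓ / η := by
    rw [Nat.le_div_iff_mul_le hη0]
    have e : (p * D + 2) * (η * (2 * η + 1) * M) =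
        (p * D + 2 * η + 2) * M * η + (2 * η * p * D + 2 * η) * (η * M) := by ring
    calc (p * D + 2 * η + 2) * M * η
        ≤ (p * D + 2 * η + 2) * M * η + (2 * η * p * D + 2 * η) * (η * M) := Nat.le_add_right _ _
      _ = (p * D + 2) * (η * (2 * η + 1) * M) := e.symm
      _ ≤ ℓ := hℓ
  have hq1 : 1 ≤ ℓ / η :=
    le_trans (le_trans hM1 (Nat.le_mul_of_pos_left M (by positivity))) hq
  rw [card_filter_eq_sum_glue3 (fun w => ringWinU c y w = true)]
  push_cast
  calc ∑ a : Fin L → Bool, ∑ b : Fin R → Bool,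
        ((univ.filter fun v : Fin ℓ → Bool => ringWinU c y (glue3 a v b) = true).card : ℝ)
      ≤ ∑ _a : Fin L → Bool, ∑ _b : Fin R → Bool, (11 / 12 * (2 : ℝ) ^ ℓ) :=
        Finset.sum_le_sum fun a _ => Finset.sum_le_sum fun b _ =>
          win_fibre_le_block_jrank_absorbed c y lam rr hp3 hyl hη hsep hM hJR hq hq1 a b
    _ = 11 / 12 * (2 : ℝ) ^ (L + ℓ + R) := by
        rw [Finset.sum_const, Finset.card_univ, Fintype.card_fun, Fintype.card_bool, Fintype.card_fin, nsmul_eq_mul,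
          Finset.sum_const, Finset.card_univ, Fintype.card_fun, Fintype.card_bool, Fintype.card_fin, nsmul_eq_mul]
        push_cast
        rw [pow_add, pow_add]
        ring

/-- **After §42 the analytic piece of the dial at a notch `η ≥ 1` IS its high-junta-rank residual** (any width `s`, `p ≠ 3`):
`BlockPiece p η ↔ BlockJSpread p η s` (`→`: forget the rank hypothesis; `←`: `blockPiece_of_jspan_jspread` with `blockJSpan_holds`). -/
theorem blockPiece_iff_blockJSpread (hp3 : p ≠ 3) {η : ℕ} (hη : 1 ≤ η) (s : ℕ) : BlockPiece p η ↔ BlockJSpread p η s := by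
  constructor
  · rintro ⟨θ, hθ, C, n₀, h⟩ E _
    exact ⟨θ, hθ, C, n₀, fun L ℓ R hn hC c y lam rr hyl hsep _ => h L ℓ R hn hC c y (fun g => ⟨lam g, rr g, hyl g⟩) hsep⟩
  · exact fun hSd => blockPiece_of_jspan_jspread p η s (blockJSpan_holds p hp3 hη) hSd

/-- **THE RESIDUAL OF THE BLOCK DIAL** (`p ≥ 5`, every notch `η ≥ 1`, every width `s`): `R5 ⟺ BlockJSpread p η s ∧ ClusteredPiece p η` —
the perturb-law conjunct of `r5_iff_block_layer` is discharged by `blockJSpan_holds`. -/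
theorem r5_iff_block_residual (hp : 5 ≤ p) {η : ℕ} (hη : 1 ≤ η) (s : ℕ) :
    WalkHardFLinSel p ↔ (BlockJSpread p η s ∧ ClusteredPiece p η) :=
  ⟨fun h => ⟨blockJSpread_of_r5 p η s h, clusteredPiece_of_r5 p η h⟩,
    fun h => r5_residual_block p η s (blockJSpan_holds p (by omega) hη) h.1 h.2⟩

/-- The residual implication by name: `BlockJSpread p η s → ClusteredPiece p η → WalkHardFLinSel p` (`p ≥ 5`, `η ≥ 1`). -/
theorem r5_of_block_residual (hp : 5 ≤ p) {η : ℕ} (hη : 1 ≤ η) (s : ℕ) (hSd : BlockJSpread p η s)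
    (hC : ClusteredPiece p η) : WalkHardFLinSel p :=
  (r5_iff_block_residual p hp hη s).mpr ⟨hSd, hC⟩

end BlockSpanPiece

/-- **ASSEMBLY TO THE TARGET BY NAME after §42**: at any notch `η ≥ 1` and width `s`, the analytic residual `BlockJSpread · η s` and the
dense core `ClusteredPiece · η` at every prime `p ≥ 5`, plus the lift `R5LiftOdd`, give `Theses.OddPrimeWalk.ManyReadersSqrtOdd`. -/
theorem closes_block_residual {η : ℕ} (hη : 1 ≤ η) (s : ℕ)
    (h₂ : ∀ (p : ℕ) [Fact p.Prime], 5 ≤ p → BlockJSpread p η s)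
    (h₃ : ∀ (p : ℕ) [Fact p.Prime], 5 ≤ p → ClusteredPiece p η)
    (h₄ : R5LiftOdd) : Theses.OddPrimeWalk.ManyReadersSqrtOdd :=
  h₄ fun p _ hp => r5_of_block_residual p hp hη s (h₂ p hp) (h₃ p hp)

/-- The target ⟺ residual ∧ core at every prime `p ≥ 5` plus the lift (any notch `η ≥ 1`, any width `s`). -/
theorem target_iff_block_residual {η : ℕ} (hη : 1 ≤ η) (s : ℕ) :
    Theses.OddPrimeWalk.ManyReadersSqrtOdd ↔
      ((∀ (p : ℕ) [Fact p.Prime], 5 ≤ p → BlockJSpread p η s) ∧ (∀ (p : ℕ) [Fact p.Prime], 5 ≤ p → ClusteredPiece p η) ∧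
        R5LiftOdd) := by
  rw [target_iff_block η s]
  constructor
  · rintro ⟨_, h₂, h₃, h₄⟩
    exact ⟨h₂, h₃, h₄⟩
  · rintro ⟨h₂, h₃, h₄⟩
    exact ⟨fun p _ hp => blockJSpan_holds p (by omega) hη, h₂, h₃, h₄⟩

end Summit.QuantumAdvantage.QuantumAdvantage.Theorems.RankDial
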